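import Literature.AlgebraicGeometry.HodgeTheory.SymmetricA3MonodromyRelations
import HarnessLib

/-!
# Picard–Lefschetz data for a pair of nodes from two COMMUTING one-node meridians (the algebra of
# programme «PL2-MERIDIANS»)

Family `hodge`, layer `Literature/AlgebraicGeometry/HodgeTheory`. Theorems only (no definition, no named fact).
Written by the prover seat `hodge-nonav-20241-p1` (g18, cell `hodge-nonav`) for crux K1-B
`VeryGeneralSignCommutatorsInHg` of route `HodgeConjecture/SignSymmetricPowers` (stmt-HodgeConjecture-19716),
registry binder hPL₂exch = `picardLefschetz_exchangedPair` (`PicardLefschetzNodalFormsKeyed`).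

THE POINT. Around a TWO-nodal member `f₁` of the universal family of degree-`d` hypersurfaces the discriminant is,
locally, two smooth transversal branches, so the pencil circle `γ` around `f₁` is homotopic to the product
`γ₀ · γ₁` of two ONE-node meridians, in either order; hence the transport along `γ` is `T = T₁ ∘ T₀ = T₀ ∘ T₁`
with `T₀, T₁` Picard–Lefschetz transformations of ONE vanishing cycle each (`IsPicardLefschetzData n d 1`, the
binder hPL₁ = `picardLefschetz_oneNode`). This file is the ALGEBRA of that situation: two one-cycle
Picard–Lefschetz transformations `Tᵢ x = x + c B(x, δᵢ) δᵢ` with the SAME coefficient which COMMUTE have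
ORTHOGONAL cycles `B(δ₀, δ₁) = 0` — for odd `n` always (the pairing is alternating), for even `n` as soon as
`T₀ ∘ T₁ ≠ 1` (otherwise `δ₁ = ±δ₀` and `T₀T₁ = T₀² = 1`) — and then `T₁ ∘ T₀ x = x + c (B(x,δ₀)δ₀ + B(x,δ₁)δ₁)`
is VERBATIM the shape of `IsPicardLefschetzData n d 2 … γ ![δ₀, δ₁] c`. No «support calculus» and no
Poincaré–Lefschetz duality on Milnor fibres enter: each factor is itself a monodromy.

* §1 abstract algebra over a `ℚ`-module with an `ε`-symmetric bilinear form: `plOne_comp_plOne_sub`,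
  `plOne_comp_plOne_eq_of_orthogonal`, `orthogonal_of_commute_of_alternating`,
  `orthogonal_of_commute_of_symmetric`;
* §2 `IsPicardLefschetzData.two_of_commuting_meridians` — in the universal family: one-node data
  `(![δ₀]; c)` along `γ₀` and `(![δ₁]; c)` along `γ₁` at the same base point, commuting transports, the
  transport along `γ` equal to their composite (and trivial off the middle degree), and the even-`n` rider
  `T ≠ 1` ⟹ `IsPicardLefschetzData n d 2 … γ ![δ₀, δ₁] c`;
* §2 `IsPicardLefschetzData.two_of_loopClassUniv_eq_trans` — the same with the hypothesis
  `loopClassUniv γ = loopClassUniv γ₀ · loopClassUniv γ₁` (transports compose, `IsRatTransport.trans`).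

Honest scope: conditional algebra; the geometric inputs (local structure of the discriminant at a two-nodal
form, the homotopy `γ ≃ γ₀γ₁ ≃ γ₁γ₀`, the conjugation of the two meridians by the exchanging symmetry) are
separate bricks. Nothing here proves hPL₂exch or HC; rung F-H1 not moved.

## References

* [VoisinHodgeII2003] C. Voisin, Hodge Theory and Complex Algebraic Geometry II, CUP 2003, §3.2.1 Thm. 3.16,
  Cor. 3.17, Rem. 3.21; §2.3.1–2.3.2 (monodromy is a representation of `π₁`).
* [ArnoldGuseinzadeVarchenko2012] V. I. Arnold, S. M. Gusein-Zade, A. N. Varchenko, Singularities of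
  Differentiable Maps II, Part I §1.3 (Picard–Lefschetz formula), §2.1 Thm. 2.1.
* [Lamotke1981] K. Lamotke, The topology of complex projective varieties after S. Lefschetz, Topology 20
  (1981), §6.
-/

noncomputable section

open CategoryTheory AlgebraicGeometry MvPolynomial
open Literature.AlgebraicTopology.SingularHomology
open Literature.AlgebraicGeometry.Motives Literature.AlgebraicGeometry.Motives.UniversalHypersurface
open Literature.AlgebraicGeometry.HodgeTheory.BettiUniverse

namespace Literature.AlgebraicGeometry.HodgeTheory

/-! ### §1 Abstract algebra: two one-cycle Picard–Lefschetz transformations with the same coefficient -/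

section Algebra

variable {V : Type*} [AddCommGroup V] [Module ℚ V] (Bl : V →ₗ[ℚ] V →ₗ[ℚ] ℚ) (c : ℚ) (δ₀ δ₁ : V)
  (T₀ T₁ : V → V)

/-- **The commutator of two one-cycle Picard–Lefschetz transformations** `Tᵢ x = x + c B(x,δᵢ) δᵢ`:
`T₀(T₁ x) − T₁(T₀ x) = c² (B(x,δ₁) B(δ₁,δ₀) δ₀ − B(x,δ₀) B(δ₀,δ₁) δ₁)`.
[cite: VoisinHodgeII2003, §3.2.1 Thm. 3.16] -/
theorem plOne_comp_plOne_sub (hT₀ : ∀ x, T₀ x = x + (c * Bl x δ₀) • δ₀)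
    (hT₁ : ∀ x, T₁ x = x + (c * Bl x δ₁) • δ₁) (x : V) :
    T₀ (T₁ x) - T₁ (T₀ x) =
      (c * c * (Bl x δ₁ * Bl δ₁ δ₀)) • δ₀ - (c * c * (Bl x δ₀ * Bl δ₀ δ₁)) • δ₁ := by
  rw [hT₀ (T₁ x), hT₁ x, hT₁ (T₀ x), hT₀ x, map_add, map_smul, map_add, map_smul, LinearMap.add_apply,
    LinearMap.smul_apply, LinearMap.add_apply, LinearMap.smul_apply, smul_eq_mul, smul_eq_mul]
  module

/-- **Orthogonal cycles compose to the two-cycle Picard–Lefschetz shape**: if `B(δ₀,δ₁) = 0` then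
`T₁ (T₀ x) = x + c (B(x,δ₀) δ₀ + B(x,δ₁) δ₁)`. [cite: VoisinHodgeII2003, §3.2.1 Thm. 3.16] -/
theorem plOne_comp_plOne_eq_of_orthogonal (hT₀ : ∀ x, T₀ x = x + (c * Bl x δ₀) • δ₀)
    (hT₁ : ∀ x, T₁ x = x + (c * Bl x δ₁) • δ₁) (h01 : Bl δ₀ δ₁ = 0) (x : V) :
    T₁ (T₀ x) = x + c • ((Bl x δ₀) • δ₀ + (Bl x δ₁) • δ₁) := by
  rw [hT₁ (T₀ x), hT₀ x, map_add, map_smul, LinearMap.add_apply, LinearMap.smul_apply, h01, smul_eq_mul,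
    mul_zero, add_zero]
  module

/-- **Odd middle dimension: commuting one-cycle transformations have orthogonal cycles.** If the form is
ALTERNATING on `δ₀` (`B(δ₀,δ₀) = 0`) and skew (`B(δ₁,δ₀) = −B(δ₀,δ₁)`), `c ≠ 0` and `T₀T₁ = T₁T₀`, then
`B(δ₀,δ₁) = 0`: evaluating the commutator at `x = δ₀` gives `c² B(δ₀,δ₁)² δ₀ = 0`, and `δ₀ = 0` also gives
`B(δ₀,δ₁) = 0`. [cite: VoisinHodgeII2003, §3.2.1 Thm. 3.16 and Rem. 3.21]
[cite: ArnoldGuseinzadeVarchenko2012, Part I §2.1 Thm. 2.1 and p. 67 Corollary] -/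
theorem orthogonal_of_commute_of_alternating (hT₀ : ∀ x, T₀ x = x + (c * Bl x δ₀) • δ₀)
    (hT₁ : ∀ x, T₁ x = x + (c * Bl x δ₁) • δ₁) (hc : c ≠ 0) (h00 : Bl δ₀ δ₀ = 0)
    (hskew : Bl δ₁ δ₀ = -Bl δ₀ δ₁) (hcomm : ∀ x, T₀ (T₁ x) = T₁ (T₀ x)) : Bl δ₀ δ₁ = 0 := by
  by_contra hq
  have h := plOne_comp_plOne_sub Bl c δ₀ δ₁ T₀ T₁ hT₀ hT₁ δ₀
  rw [hcomm δ₀, sub_self, h00, zero_mul, mul_zero, zero_smul, sub_zero, hskew] at h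
  have hcoef : c * c * (Bl δ₀ δ₁ * -Bl δ₀ δ₁) ≠ 0 :=
    mul_ne_zero (mul_ne_zero hc hc) (mul_ne_zero hq (neg_ne_zero.mpr hq))
  have hδ₀ : δ₀ = 0 := (smul_eq_zero.mp h.symm).resolve_left hcoef
  exact hq (by rw [hδ₀, map_zero, LinearMap.zero_apply])

/-- **Even middle dimension: commuting one-cycle reflections with `T₀T₁ ≠ 1` have orthogonal cycles.** If the
form is SYMMETRIC on the two cycles (`B(δ₁,δ₀) = B(δ₀,δ₁)`), `c B(δ₀,δ₀) = c B(δ₁,δ₁) = −2` (so the `Tᵢ` are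
reflections) and `T₀T₁ = T₁T₀` but `T₀ ∘ T₁ ≠ id`, then `B(δ₀,δ₁) = 0`: otherwise the commutator at `δ₀` forces
`δ₁ = ±δ₀`, whence `T₁ = T₀` and `T₀T₁ = T₀² = 1`. [cite: VoisinHodgeII2003, §3.2.1 Thm. 3.16 and Rem. 3.21]
[cite: ArnoldGuseinzadeVarchenko2012, Part I §2.1 Thm. 2.1 and p. 67 Corollary] -/
theorem orthogonal_of_commute_of_symmetric (hT₀ : ∀ x, T₀ x = x + (c * Bl x δ₀) • δ₀)
    (hT₁ : ∀ x, T₁ x = x + (c * Bl x δ₁) • δ₁) (h0 : c * Bl δ₀ δ₀ = -2) (h1 : c * Bl δ₁ δ₁ = -2)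
    (hsymm : Bl δ₁ δ₀ = Bl δ₀ δ₁) (hcomm : ∀ x, T₀ (T₁ x) = T₁ (T₀ x)) (hne : ∃ x, T₀ (T₁ x) ≠ x) :
    Bl δ₀ δ₁ = 0 := by
  by_contra hq
  have hc : c ≠ 0 := by rintro rfl; norm_num at h0
  have hb0 : Bl δ₀ δ₀ ≠ 0 := by rintro h; rw [h, mul_zero] at h0; norm_num at h0
  -- the commutator at `δ₀`: `B(δ₀,δ₁) δ₀ = B(δ₀,δ₀) δ₁`
  have h := plOne_comp_plOne_sub Bl c δ₀ δ₁ T₀ T₁ hT₀ hT₁ δ₀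
  rw [hcomm δ₀, sub_self, hsymm] at h
  have hlin : (Bl δ₀ δ₁) • δ₀ = (Bl δ₀ δ₀) • δ₁ := by
    have h' : (c * c * Bl δ₀ δ₁) • ((Bl δ₀ δ₁) • δ₀ - (Bl δ₀ δ₀) • δ₁) = 0 := by
      rw [smul_sub, smul_smul, smul_smul, h]
      congr 2 <;> ring
    rcases smul_eq_zero.mp h' with h'' | h''
    · exact absurd h'' (mul_ne_zero (mul_ne_zero hc hc) hq)
    · exact sub_eq_zero.mp h''
  -- so `δ₁ = λ δ₀` with `λ = B(δ₀,δ₁)/B(δ₀,δ₀)`, and `λ² = 1`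
  set lam : ℚ := Bl δ₀ δ₁ / Bl δ₀ δ₀ with hlam
  have hδ₁ : δ₁ = lam • δ₀ := by
    have := congrArg (fun v => (Bl δ₀ δ₀)⁻¹ • v) hlin
    simp only [smul_smul, inv_mul_cancel₀ hb0, one_smul] at this
    rw [← this, hlam, div_eq_inv_mul]
  have hlam2 : lam * lam = 1 := by
    have h1' : Bl δ₁ δ₁ = lam * lam * Bl δ₀ δ₀ := by
      rw [hδ₁]; simp only [map_smul, LinearMap.smul_apply, smul_eq_mul]; ring
    have h2 : lam * lam * (c * Bl δ₀ δ₀) = 1 * (c * Bl δ₀ δ₀) := by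
      calc lam * lam * (c * Bl δ₀ δ₀) = c * (lam * lam * Bl δ₀ δ₀) := by ring
        _ = c * Bl δ₁ δ₁ := by rw [h1']
        _ = 1 * (c * Bl δ₀ δ₀) := by rw [h1, one_mul, h0]
    exact mul_right_cancel₀ (by rw [h0]; norm_num) h2
  -- hence `T₁ = T₀` and `T₀ ∘ T₁ = T₀² = id`
  have hT₁' : ∀ x, T₁ x = T₀ x := by
    intro x
    rw [hT₁ x, hT₀ x, hδ₁, map_smul, smul_eq_mul, smul_smul,
      show c * (lam * Bl x δ₀) * lam = lam * lam * (c * Bl x δ₀) by ring, hlam2, one_mul]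
  obtain ⟨x, hx⟩ := hne
  apply hx
  rw [hT₁' x, hT₀ (T₀ x), hT₀ x, map_add, map_smul, LinearMap.add_apply, LinearMap.smul_apply, smul_eq_mul,
    add_assoc, ← add_smul]
  have : c * Bl x δ₀ + c * (Bl x δ₀ + c * Bl x δ₀ * Bl δ₀ δ₀) = Bl x δ₀ * (2 * c + c * (c * Bl δ₀ δ₀)) := by ring
  rw [this, h0]; ring_nf; rw [zero_smul, add_zero]

end Algebra

/-! ### §2 In the universal family: two-node Picard–Lefschetz data from two commuting one-node meridians -/

section Family

variable {n d : ℕ} {hn : 1 ≤ n} {hd : 1 ≤ d}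
  {hU : IsCohomologicallyLocallyTrivialOn (family ℂ n d) Set.univ} {s : ComplexPoints (base ℂ n d)}
  {γ γ₀ γ₁ : Path s s} {c : ℚ} {δ₀ δ₁ : bettiCohomology (fiberOver (family ℂ n d) s) n}
  {T T₀ T₁ : bettiCohomology (fiberOver (family ℂ n d) s) n ≃ₗ[ℚ] bettiCohomology (fiberOver (family ℂ n d) s) n}

/-- **Two-node Picard–Lefschetz data from two COMMUTING one-node meridians.** In the universal family of
degree-`d` hypersurfaces in `ℙⁿ⁺¹`: one-node data `(![δ₀]; c)` along `γ₀` and `(![δ₁]; c)` along `γ₁` at the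
base point `s` (same coefficient), THE transports `T₀, T₁` along them commuting, a loop `γ` at `s` whose
transport in degree `n` is `T₀ ≫ T₁` and in the other degrees the identity, and — for even `n` — `T₀ ≫ T₁ ≠ 1`:
then `(![δ₀, δ₁]; c)` are Picard–Lefschetz data for `γ` (`IsPicardLefschetzData n d 2 … γ ![δ₀, δ₁] c`):
orthogonality from `orthogonal_of_commute_of_alternating` (odd `n`, `B(δ,δ) = 0` and `tr(x∪y) = −tr(y∪x)`) /
`orthogonal_of_commute_of_symmetric` (even `n`, `cB(δᵢ,δᵢ) = −2`), and the monodromy formula from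
`plOne_comp_plOne_eq_of_orthogonal`. [cite: VoisinHodgeII2003, §3.2.1 Thm. 3.16, Cor. 3.17, Rem. 3.21]
[cite: ArnoldGuseinzadeVarchenko2012, Part I §1.3 and §2.1 Thm. 2.1, p. 67 Corollary] -/
theorem IsPicardLefschetzData.two_of_commuting_meridians
    (h₀ : IsPicardLefschetzData n d 1 hn hd hU γ₀ ![δ₀] c) (h₁ : IsPicardLefschetzData n d 1 hn hd hU γ₁ ![δ₁] c)
    (hT₀ : IsRatTransport (family ℂ n d) n hU (loopClassUniv n d γ₀) T₀)
    (hT₁ : IsRatTransport (family ℂ n d) n hU (loopClassUniv n d γ₁) T₁)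
    (hT : IsRatTransport (family ℂ n d) n hU (loopClassUniv n d γ) (T₀.trans T₁))
    (hoff : ∀ k', k' ≠ n → IsRatTransport (family ℂ n d) k' hU (loopClassUniv n d γ) (LinearEquiv.refl ℚ _))
    (hcomm : T₀.trans T₁ = T₁.trans T₀) (hne : Even n → T₀.trans T₁ ≠ LinearEquiv.refl ℚ _) :
    IsPicardLefschetzData n d 2 hn hd hU γ ![δ₀, δ₁] c := by
  obtain ⟨hc, -, ⟨T₀', hT₀', hT₀x⟩, -, heven₀, hodd₀⟩ := h₀
  obtain ⟨-, -, ⟨T₁', hT₁', hT₁x⟩, -, heven₁, hodd₁⟩ := h₁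
  have e0 : T₀' = T₀ := isRatTransport_unique_family hT₀' hT₀
  have e1 : T₁' = T₁ := isRatTransport_unique_family hT₁' hT₁
  rw [e0] at hT₀x
  rw [e1] at hT₁x
  set hX := (isSmoothProjectiveFamily_family ℂ hn hd).isSmoothProjective s with hXdef
  set Bl : bettiCohomology (fiberOver (family ℂ n d) s) n →ₗ[ℚ] bettiCohomology (fiberOver (family ℂ n d) s) n →ₗ[ℚ] ℚ :=
    (cup (fiberOver (family ℂ n d) s) n n).compr₂ (tr hX (n + n)) with hBl
  have hε : ∀ x y, Bl x y = (-1 : ℚ) ^ n * Bl y x := fun x y => tr_cup_comm hX x y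
  have hN₀ : ∀ x, T₀ x = x + (c * Bl x δ₀) • δ₀ := fun x => by
    rw [hT₀x x, Fin.sum_univ_one, Matrix.cons_val_zero, smul_smul]; rfl
  have hN₁ : ∀ x, T₁ x = x + (c * Bl x δ₁) • δ₁ := fun x => by
    rw [hT₁x x, Fin.sum_univ_one, Matrix.cons_val_zero, smul_smul]; rfl
  have hcomm' : ∀ x, T₀ (T₁ x) = T₁ (T₀ x) := fun x => by
    have := LinearEquiv.congr_fun hcomm x
    simpa only [LinearEquiv.trans_apply] using this.symm
  -- orthogonality of the two cycles
  have horth : Bl δ₀ δ₁ = 0 := by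
    rcases Nat.even_or_odd n with hev | hod
    · have h0 := (heven₀ hev 0).1
      have h1 := (heven₁ hev 0).1
      simp only [Matrix.cons_val_zero] at h0 h1
      refine orthogonal_of_commute_of_symmetric Bl c δ₀ δ₁ T₀ T₁ hN₀ hN₁ h0 h1 ?_ hcomm' ?_
      · rw [hε δ₁ δ₀, Even.neg_one_pow hev, one_mul]
      · by_contra hall
        apply hne hev
        refine LinearEquiv.ext fun x => ?_
        rw [LinearEquiv.trans_apply, LinearEquiv.refl_apply, ← hcomm' x]
        by_contra hx
        exact hall ⟨x, hx⟩
    · have h0 := hodd₀ hod 0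
      simp only [Matrix.cons_val_zero] at h0
      refine orthogonal_of_commute_of_alternating Bl c δ₀ δ₁ T₀ T₁ hN₀ hN₁ hc h0 ?_ hcomm'
      rw [hε δ₁ δ₀, Odd.neg_one_pow hod, neg_one_mul]
  have horth' : Bl δ₁ δ₀ = 0 := by rw [hε δ₁ δ₀, horth, mul_zero]
  refine ⟨hc, ?_, ⟨T₀.trans T₁, hT, fun x => ?_⟩, hoff, ?_, ?_⟩
  · -- pairwise orthogonality of `![δ₀, δ₁]`
    intro i i' hii'
    fin_cases i <;> fin_cases i'
    · exact absurd rfl hii'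
    · exact horth
    · exact horth'
    · exact absurd rfl hii'
  · -- the two-cycle Picard–Lefschetz formula
    rw [LinearEquiv.trans_apply, plOne_comp_plOne_eq_of_orthogonal Bl c δ₀ δ₁ T₀ T₁ hN₀ hN₁ horth x,
      Fin.sum_univ_two, Matrix.cons_val_zero, Matrix.cons_val_one, Matrix.cons_val_zero]
    rfl
  · intro hev i
    fin_cases i
    · exact heven₀ hev 0
    · exact heven₁ hev 0
  · intro hod i
    fin_cases i
    · exact hodd₀ hod 0
    · exact hodd₁ hod 0

/-- **The same with the loop relation `[γ] = [γ₀]·[γ₁]`**: the transport along `γ` is then `T₀ ≫ T₁` in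
degree `n` (`IsRatTransport.trans`) and the identity in the other degrees (clause (4) of the one-node data).
[cite: VoisinHodgeII2003, §3.2.1 Thm. 3.16 and §3.1.2] -/
theorem IsPicardLefschetzData.two_of_loopClassUniv_eq_trans
    (h₀ : IsPicardLefschetzData n d 1 hn hd hU γ₀ ![δ₀] c) (h₁ : IsPicardLefschetzData n d 1 hn hd hU γ₁ ![δ₁] c)
    (hT₀ : IsRatTransport (family ℂ n d) n hU (loopClassUniv n d γ₀) T₀)
    (hT₁ : IsRatTransport (family ℂ n d) n hU (loopClassUniv n d γ₁) T₁)
    (hγ : loopClassUniv n d γ = (loopClassUniv n d γ₀).trans (loopClassUniv n d γ₁))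
    (hcomm : T₀.trans T₁ = T₁.trans T₀) (hne : Even n → T₀.trans T₁ ≠ LinearEquiv.refl ℚ _) :
    IsPicardLefschetzData n d 2 hn hd hU γ ![δ₀, δ₁] c := by
  have hT : IsRatTransport (family ℂ n d) n hU (loopClassUniv n d γ) (T₀.trans T₁) := by
    rw [hγ]; exact hT₀.trans (family ℂ n d) n hU hT₁
  have hoff : ∀ k', k' ≠ n →
      IsRatTransport (family ℂ n d) k' hU (loopClassUniv n d γ) (LinearEquiv.refl ℚ _) := by
    intro k' hk'
    have h := (h₀.2.2.2.1 k' hk').trans (family ℂ n d) k' hU (h₁.2.2.2.1 k' hk')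
    rw [← hγ] at h
    exact h
  exact IsPicardLefschetzData.two_of_commuting_meridians h₀ h₁ hT₀ hT₁ hT hoff hcomm hne

end Family

end Literature.AlgebraicGeometry.HodgeTheory

end
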